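import Mathlib
import HarnessLib
import Summits.HubbardSuperconductivity.HubbardSuperconductivity.Theorems.KLProgrammeKLRegimeSplitThermalLayerExt

/-!
# K3 gen-8-FLOW (stmt 20437 `KLRegimeEngineV17F2`, stub (C), door (B)): the SCALE WINDOW of the reading frequency —
# `4^n ≤ 6/m_ω ≤ 384·4^n` at `Λ = Λ_n`, `ω = ±ω₀`, on the extended ladder `n ≤ n_β + 1`

Cell gate-hubbard-kl, seat p2 g12.  The history-keyed door (B) (`…EngineFrameShiftMomentDoorFlowHist`) asks the window
`4^n ≤ 6 / max |ω_i| (Λ/2) ≤ X₁·4^n` of the reading frequency.  At the engine's data — cutoff `Λ = Λ_n = klScale klE0 n = 4^{−n}/32`, reading indices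
`ω₀`, `−ω₀` (`|ω| = π/β`), `β ≥ klBetaMin`, `n ≤ nScales β + 1` — this holds with `X₁ = 384`: the upper bound because `m_ω ≥ Λ_n/2`, the lower one
because `π/β ≤ 4Λ_n` on the extended ladder (`klte_pi_div_le_four_mul_klScale`), so `m_ω ≤ 4Λ_n` and `6/m_ω ≥ 48·4^n`.

* `six_div_max_le_scaleWindow` — `6 / max |ω_i| (Λ_n/2) ≤ 384·4^n` (every index);
* `four_pow_le_six_div_max_of_abs_le` — `4^n ≤ 6 / max |ω_i| (Λ_n/2)` whenever `|ω_i| ≤ 4Λ_n`;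
* **`scaleWindow_omega0`**, **`scaleWindow_omega0_rev`** — both bounds at `ω₀` and `−ω₀` for `β ≥ klBetaMin`, `n ≤ nScales β + 1`;
* `scaleWindow_of_eq_or` — the `i = ip ∨ i = im` form of the reading door with `(ip, im) = (ω₀, −ω₀)`.

Pure bookkeeping; nothing asserts superconductivity.
-/

noncomputable section

namespace Summit.HubbardSuperconductivity.HubbardSuperconductivity.Theorems.EngineV8

set_option linter.dupNamespace false -- summit = problem name (single-conjunct summit), D-0017

open Literature.MathematicalPhysics.QuantumLattice Literature.Probability.LatticeModels
open Summit.HubbardSuperconductivity.HubbardSuperconductivity.Theorems.KLRegimeSplit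
open Summit.HubbardSuperconductivity.HubbardSuperconductivity.Theorems.KLProgrammeLegKernels

variable {M : ℕ}

/-- `Λ_n = 4^{−n}/32` against the clean power: `Λ_n · 4^n = 1/32` (numeric form of `…EngineE4ScaleDoor.klScale_klE0_mul_four_pow`, kept local to
avoid that module's imports). -/
private theorem klScale_mul_four_pow_eq (n : ℕ) : klScale klE0 n * (4 : ℝ) ^ n = 1 / 32 := by
  unfold klScale klE0
  have h : (4 : ℝ) ^ n ≠ 0 := pow_ne_zero _ (by norm_num)
  field_simp

/-- **Upper end of the window** (every index): `6 / max |ω_i| (Λ_n/2) ≤ 384·4^n`. -/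
theorem six_div_max_le_scaleWindow (β : ℝ) (i : MatsubaraIdx M) (n : ℕ) :
    6 / max |matsubaraFreq β M i| (klScale klE0 n / 2) ≤ 384 * (4 : ℝ) ^ n := by
  have hΛ := klth_klScale_pos n
  have hm : klScale klE0 n / 2 ≤ max |matsubaraFreq β M i| (klScale klE0 n / 2) := le_max_right _ _
  have hmpos : 0 < max |matsubaraFreq β M i| (klScale klE0 n / 2) := lt_of_lt_of_le (by positivity) hm
  rw [div_le_iff₀ hmpos]
  have h := klScale_mul_four_pow_eq n
  nlinarith

/-- **Lower end of the window** for an index below four scales: `|ω_i| ≤ 4Λ_n` gives `4^n ≤ 6 / max |ω_i| (Λ_n/2)` (indeed `48·4^n ≤ …`). -/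
theorem four_pow_le_six_div_max_of_abs_le {β : ℝ} {i : MatsubaraIdx M} {n : ℕ} (hi : |matsubaraFreq β M i| ≤ 4 * klScale klE0 n) :
    (4 : ℝ) ^ n ≤ 6 / max |matsubaraFreq β M i| (klScale klE0 n / 2) := by
  have hΛ := klth_klScale_pos n
  have hm : max |matsubaraFreq β M i| (klScale klE0 n / 2) ≤ 4 * klScale klE0 n := max_le hi (by linarith)
  have hmpos : 0 < max |matsubaraFreq β M i| (klScale klE0 n / 2) := lt_of_lt_of_le (by positivity) (le_max_right _ _)
  rw [le_div_iff₀ hmpos]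
  have h := klScale_mul_four_pow_eq n
  have h4 : (0 : ℝ) ≤ (4 : ℝ) ^ n := by positivity
  nlinarith [mul_le_mul_of_nonneg_left hm h4]

/-- **The window at `ω₀`**: for `β ≥ klBetaMin` and `n ≤ nScales β + 1`, `4^n ≤ 6 / max |ω₀| (Λ_n/2) ≤ 384·4^n`. -/
theorem scaleWindow_omega0 [NeZero M] {β : ℝ} (hβ : klBetaMin ≤ β) {n : ℕ} (hn : n ≤ nScales β + 1) :
    (4 : ℝ) ^ n ≤ 6 / max |matsubaraFreq β M (omega0 M)| (klScale klE0 n / 2) ∧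
      6 / max |matsubaraFreq β M (omega0 M)| (klScale klE0 n / 2) ≤ 384 * (4 : ℝ) ^ n := by
  refine ⟨four_pow_le_six_div_max_of_abs_le ?_, six_div_max_le_scaleWindow β _ n⟩
  rw [matsubaraFreq_omega0, abs_of_pos (div_pos Real.pi_pos (pos_of_klBetaMin_le hβ))]
  exact klte_pi_div_le_four_mul_klScale hβ hn

/-- **The window at `−ω₀`**. -/
theorem scaleWindow_omega0_rev [NeZero M] {β : ℝ} (hβ : klBetaMin ≤ β) {n : ℕ} (hn : n ≤ nScales β + 1) :
    (4 : ℝ) ^ n ≤ 6 / max |matsubaraFreq β M (omega0 M).rev| (klScale klE0 n / 2) ∧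
      6 / max |matsubaraFreq β M (omega0 M).rev| (klScale klE0 n / 2) ≤ 384 * (4 : ℝ) ^ n := by
  refine ⟨four_pow_le_six_div_max_of_abs_le ?_, six_div_max_le_scaleWindow β _ n⟩
  rw [matsubaraFreq_omega0_rev, abs_neg, abs_of_pos (div_pos Real.pi_pos (pos_of_klBetaMin_le hβ))]
  exact klte_pi_div_le_four_mul_klScale hβ hn

/-- **The window in the reading door's `i = ip ∨ i = im` form** with `(ip, im) = (ω₀, −ω₀)`: both hypotheses `hlo`, `hhi` of
`norm_iteratedFDeriv_evalM_symInterp_flowStep_response_le_of_hist` at `Λ = Λ_n`, `X₁ = 384`. -/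
theorem scaleWindow_of_eq_or [NeZero M] {β : ℝ} (hβ : klBetaMin ≤ β) {n : ℕ} (hn : n ≤ nScales β + 1) :
    (∀ i : MatsubaraIdx M, i = omega0 M ∨ i = (omega0 M).rev → (4 : ℝ) ^ n ≤ 6 / max |matsubaraFreq β M i| (klScale klE0 n / 2)) ∧
      (∀ i : MatsubaraIdx M, i = omega0 M ∨ i = (omega0 M).rev →
        6 / max |matsubaraFreq β M i| (klScale klE0 n / 2) ≤ 384 * (4 : ℝ) ^ n) := by
  refine ⟨fun i hi => ?_, fun i _ => six_div_max_le_scaleWindow β i n⟩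
  rcases hi with rfl | rfl
  · exact (scaleWindow_omega0 hβ hn).1
  · exact (scaleWindow_omega0_rev hβ hn).1

end Summit.HubbardSuperconductivity.HubbardSuperconductivity.Theorems.EngineV8

end
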